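import Literature.MathematicalPhysics.QuantumLattice.GrassmannLaplacianPairWick
import Literature.MathematicalPhysics.QuantumLattice.GrassmannChargeScaling
import Literature.MathematicalPhysics.QuantumLattice.GrassmannKernelsGenProd
import Literature.Analysis.InnerProduct.GramHadamard
import HarnessLib

/-!
# Charged covariances: the determinant rule in block form and the Gram–Hadamard bound for `∫ dμ_C ψ(Z₁)⋯ψ(Z_N)`

Topic `Literature/MathematicalPhysics/QuantumLattice`; continuation of `GrassmannLaplacianPairWick.lean` for
the `e^{Δ_C}` calculus of Salmhofer 1999, §4.3 (`gaussExpect R C = constPart ∘ e^{Δ_C}`), towards the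
loop-line estimate of the single-scale tree expansion in the Laplacian host.  A covariance is **charged**
for a charge map `q : Γ → Bool` if it pairs only labels of opposite charge (`q X = q Y → C X Y = 0`;
`ψ̄ = ψ⁺` the labels with `q = true`).  PROVED here:

* `map_mulLeft_genProd`, `gaussExpect_genProd_eq_zero_of_charge` — the **`U(1)` selection rule**: the
  expectation of a monomial with unequal numbers of barred and unbarred fields vanishes (charge scaling
  `ψ̄ ↦ 2ψ̄`, `ψ ↦ ½ψ` leaves a charged covariance invariant, `GrassmannChargeScaling.gaussConv_map_mulLeft`);
* `involute_genProd`, `genProd_mem_fieldSubalgebra_range`, `genProd_comp_perm` (antisymmetry, via Mathlib's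
  alternating `ExteriorAlgebra.ιMulti`), `genProd_comp_finCongr`, `genProd_append`;
* **`gaussExpect_genProd_mul_genProd`** — the determinant rule in BLOCK form:
  `∫ dμ_C ψ(X̄₀)⋯ψ(X̄_{k-1}) ψ(X₀)⋯ψ(X_{k-1}) = (-1)^{k(k-1)/2} det [A(X̄_i, X_j)]` when `A(X̄_i, X̄_j) = 0`
  (`A = contr C` the two-point function), by the Laplace expansion along the first row
  (`Matrix.det_succ_row_zero`, `grassmannDeriv_genProd`);
* **`norm_gaussExpect_genProd_le`** — the **Gram–Hadamard bound** (Feldman–Knörrer–Trubowitz 2004,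
  App. B; Benfatto–Giuliani–Mastropietro 2006, (2.80)): if the two-point function of a charged covariance is
  in Gram form on the mixed pairs, `A(X̄, Y) = ⟪f X̄, g Y⟫` with `‖f‖, ‖g‖ ≤ κ`, then for EVERY label string
  `Z`, `‖∫ dμ_C ψ(Z₁)⋯ψ(Z_N)‖ ≤ κ^N` — sort the string into block form (a permutation costs a sign),
  apply the determinant rule and Gram–Hadamard (`norm_det_inner_le_prod_norm_mul_prod_norm`); unbalanced
  strings give zero.  No factorial in `N`: the Pauli principle for the loop lines.

Everything is proved; no named fact.

## Sources

J. Feldman, H. Knörrer, E. Trubowitz, Commun. Math. Phys. 247 (2004) 195–242, App. B (integral bounds from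
Gram representations) (`FeldmanKnorrerTrubowitz2004`); *Fermionic Functional Integrals and the
Renormalization Group* (AMS 2002), §I.3, App. B (`FeldmanKnorrerTrubowitz2002`); G. Benfatto, A. Giuliani,
V. Mastropietro, Ann. Henri Poincaré 7 (2006), (2.80) (`BenfattoGiulianiMastropietro2006`); M. Salmhofer,
*Renormalization* (1999), §4.3 (`Salmhofer1999`).
-/

noncomputable section

namespace Literature.MathematicalPhysics.QuantumLattice

open GrassmannAlgebra Matrix Finset
open scoped InnerProductSpace

/-! ### Monomials: scaling, parity, support, antisymmetry -/

section Monomials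

variable (R : Type*) [CommRing R] {Γ : Type*} [DecidableEq Γ]

/-- **Charge scalings act diagonally on monomials**: `S_c (ψ(Y₀)⋯ψ(Y_{m-1})) = (∏ᵢ c(Yᵢ)) ψ(Y₀)⋯ψ(Y_{m-1})`.
[folklore] -/
theorem map_mulLeft_genProd (c : Γ → R) : ∀ {m : ℕ} (Y : Fin m → Γ),
    ExteriorAlgebra.map (LinearMap.mulLeft R c) (genProd R Y) = (∏ i, c (Y i)) • genProd R Y
  | 0, Y => by simp
  | m + 1, Y => by
    rw [genProd_succ, map_mul, map_mulLeft_gen, map_mulLeft_genProd c (Fin.tail Y), smul_mul_smul_comm,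
      Fin.prod_univ_succ]
    rfl

/-- The parity automorphism on a monomial of degree `m` is `(-1)^m`. [folklore] -/
theorem involute_genProd : ∀ {m : ℕ} (Y : Fin m → Γ),
    CliffordAlgebra.involute (genProd R Y) = ((-1 : R) ^ m) • genProd R Y
  | 0, Y => by simp
  | m + 1, Y => by
    rw [genProd_succ, map_mul, involute_gen, involute_genProd (Fin.tail Y), neg_mul, mul_smul_comm, ← neg_smul,
      pow_succ, mul_neg_one]

/-- A monomial lies in the subalgebra of its own fields. [folklore] -/
theorem genProd_mem_fieldSubalgebra_range {m : ℕ} (Y : Fin m → Γ) :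
    genProd R Y ∈ fieldSubalgebra R (Set.range Y) := by
  unfold genProd
  refine Subalgebra.list_prod_mem _ fun a ha => ?_
  rw [List.mem_ofFn] at ha
  obtain ⟨i, rfl⟩ := ha
  exact gen_mem_fieldSubalgebra R ⟨i, rfl⟩

/-- **Monomials are antisymmetric in their labels**: `ψ(Y_{σ 0})⋯ψ(Y_{σ(m-1)}) = sign σ · ψ(Y₀)⋯ψ(Y_{m-1})`
(Mathlib's alternating map `ExteriorAlgebra.ιMulti`). [folklore] -/
theorem genProd_comp_perm {m : ℕ} (Y : Fin m → Γ) (σ : Equiv.Perm (Fin m)) :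
    genProd R (Y ∘ σ) = ((Equiv.Perm.sign σ : ℤ) : R) • genProd R Y := by
  have h : ∀ W : Fin m → Γ, genProd R W = ExteriorAlgebra.ιMulti R m (fun i => Pi.single (W i) (1 : R)) := fun W => by
    rw [ExteriorAlgebra.ιMulti_apply]; rfl
  rw [h, h, show (fun i => Pi.single ((Y ∘ σ) i) (1 : R)) = (fun i => Pi.single (Y i) (1 : R)) ∘ σ from rfl,
    AlternatingMap.map_perm, Units.smul_def, ← Int.cast_smul_eq_zsmul R]

/-- Reindexing along an equality of lengths does not change the monomial. [folklore] -/
theorem genProd_comp_finCongr {n m : ℕ} (h : n = m) (Y : Fin m → Γ) : genProd R (Y ∘ finCongr h) = genProd R Y := by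
  subst h
  rfl

/-- Concatenated label strings give the product of the monomials. [folklore] -/
theorem genProd_append {a b : ℕ} (Xb : Fin a → Γ) (Xu : Fin b → Γ) :
    genProd R (Fin.append Xb Xu) = genProd R Xb * genProd R Xu := by
  have h : (fun i => gen R (Fin.append Xb Xu i)) = Fin.append (fun i => gen R (Xb i)) (fun j => gen R (Xu j)) := by
    funext i
    refine Fin.addCases (fun i => ?_) (fun j => ?_) i
    · rw [Fin.append_left, Fin.append_left]
    · rw [Fin.append_right, Fin.append_right]
  rw [genProd, genProd, genProd, h, List.ofFn_fin_append, List.prod_append]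

end Monomials

/-! ### Charged covariances: the selection rule and the block determinant rule -/

section Charged

variable (R : Type*) [CommRing R] [Algebra ℚ R] {Γ : Type*} [Fintype Γ] [DecidableEq Γ]

/-- **The `U(1)` selection rule for a charged covariance**: if `C` pairs only labels of opposite charge,
the Gaussian expectation of a monomial with unequal numbers of barred (`q = true`) and unbarred fields
vanishes (charge scaling `ψ̄ ↦ 2ψ̄`, `ψ ↦ ½ψ`; Benfatto–Giuliani–Mastropietro 2006, §2.1, symmetry (2)).
[folklore] -/
theorem gaussExpect_genProd_eq_zero_of_charge (q : Γ → Bool) (C : Matrix Γ Γ R)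
    (hC : ∀ X Y, q X = q Y → C X Y = 0) {m : ℕ} (Y : Fin m → Γ)
    (h : (univ.filter fun i => q (Y i) = true).card ≠ (univ.filter fun i => ¬ q (Y i) = true).card) :
    gaussExpect R C (genProd R Y) = 0 := by
  set c : Γ → R := fun X => if q X = true then algebraMap ℚ R 2 else algebraMap ℚ R (1 / 2) with hc
  -- the scaled covariance is `C` itself
  have hCc : (Matrix.of fun X Y => c X * c Y * C X Y) = C := by
    ext X Y
    rw [Matrix.of_apply]
    by_cases hq : q X = q Y
    · rw [hC X Y hq, mul_zero]
    · have hXY : (q X = true ∧ q Y = false) ∨ (q X = false ∧ q Y = true) := by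
        cases hX : q X <;> cases hY : q Y <;> simp_all
      have h1 : c X * c Y = 1 := by
        rcases hXY with ⟨hX, hY⟩ | ⟨hX, hY⟩
        · simp only [hc, hX, hY, if_true, Bool.false_eq_true, if_false]
          rw [← map_mul, show (2 : ℚ) * (1 / 2) = 1 by norm_num, map_one]
        · simp only [hc, hX, hY, if_true, Bool.false_eq_true, if_false]
          rw [← map_mul, show (1 / 2 : ℚ) * 2 = 1 by norm_num, map_one]
      rw [h1, one_mul]
  -- covariance of `e^{Δ_C}` under the scaling, read in the constant part
  have key := congrArg (constPart R) (gaussConv_map_mulLeft R c C (genProd R Y))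
  rw [hCc, constPart_map, map_mulLeft_genProd, map_smul, map_smul, smul_eq_mul, ← gaussExpect_apply] at key
  -- the scaling factor is the rational `2^a (1/2)^b ≠ 1`
  set a := (univ.filter fun i => q (Y i) = true).card with ha
  set b := (univ.filter fun i => ¬ q (Y i) = true).card with hb
  have hprod : ∏ i, c (Y i) = algebraMap ℚ R (2 ^ a * (1 / 2) ^ b) := by
    rw [hc]
    dsimp only
    rw [prod_ite, prod_const, prod_const, map_mul, map_pow, map_pow]
  have hne : (2 : ℚ) ^ a * (1 / 2) ^ b - 1 ≠ 0 := by
    intro h0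
    apply h
    have h2 : (2 : ℚ) ^ a = 2 ^ b := by
      have h' : (2 : ℚ) ^ a * (1 / 2) ^ b * 2 ^ b = 2 ^ b := by rw [sub_eq_zero.1 h0, one_mul]
      rwa [mul_assoc, ← mul_pow, show (1 / 2 : ℚ) * 2 = 1 by norm_num, one_pow, mul_one] at h'
    exact Nat.pow_right_injective (le_refl 2) (by exact_mod_cast h2)
  have hunit : IsUnit (algebraMap ℚ R (2 ^ a * (1 / 2) ^ b - 1)) := (IsUnit.mk0 _ hne).map _
  have hzero : algebraMap ℚ R (2 ^ a * (1 / 2) ^ b - 1) * gaussExpect R C (genProd R Y) = 0 := by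
    rw [map_sub, map_one, sub_mul, one_mul, ← hprod, key, sub_self]
  exact (hunit.mul_right_eq_zero).1 hzero

/-- **The determinant rule in block form** (Wick's rule for a charged covariance; Feldman–Knörrer–Trubowitz
2002, Prop. I.18): if the barred labels do not contract among themselves, `A(X̄_i, X̄_j) = 0`, then
`∫ dμ_C ψ(X̄₀)⋯ψ(X̄_{k-1}) ψ(X₀)⋯ψ(X_{k-1}) = (-1)^{k(k-1)/2} det [A(X̄_i, X_j)]_{i,j}` (the sign of sorting
the block form into the paired form `ψ̄₀ψ₀ψ̄₁ψ₁⋯`). [cite: FeldmanKnorrerTrubowitz2002, §I.3 Prop. I.18] -/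
theorem gaussExpect_genProd_mul_genProd (C : Matrix Γ Γ R) :
    ∀ {k : ℕ} (Xb Xu : Fin k → Γ), (∀ i j, contr R C (Xb i) (Xb j) = 0) →
      gaussExpect R C (genProd R Xb * genProd R Xu) =
        (-1 : R) ^ (k.choose 2) * (Matrix.of fun i j => contr R C (Xb i) (Xu j)).det
  | 0, Xb, Xu, _ => by simp [det_isEmpty]
  | k + 1, Xb, Xu, hb => by
    have hb' : ∀ i j, contr R C (Fin.tail Xb i) (Fin.tail Xb j) = 0 := fun i j => hb i.succ j.succ
    -- the pairing operator of `ψ(X̄₀)` kills the other barred fields …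
    have hkill : ∑ Y, contr R C (Xb 0) Y • grassmannDeriv R Y (genProd R (Fin.tail Xb)) = 0 := by
      refine sum_eq_zero fun Y _ => ?_
      by_cases hY : Y ∈ Set.range (Fin.tail Xb)
      · obtain ⟨i, rfl⟩ := hY
        rw [show Fin.tail Xb i = Xb i.succ from rfl, hb 0 i.succ, zero_smul]
      · rw [grassmannDeriv_eq_zero_of_mem_fieldSubalgebra R hY (genProd_mem_fieldSubalgebra_range R _), smul_zero]
    -- … and deletes one unbarred field
    have hderu : ∑ Y, contr R C (Xb 0) Y • grassmannDeriv R Y (genProd R Xu) =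
        ∑ j : Fin (k + 1), contr R C (Xb 0) (Xu j) • (((-1 : R) ^ (j : ℕ)) • genProd R (Xu ∘ j.succAbove)) := by
      simp only [grassmannDeriv_genProd, smul_sum, smul_ite, smul_zero]
      rw [sum_comm]
      exact sum_congr rfl fun j _ => by rw [sum_ite_eq', if_pos (mem_univ _)]
    have hminor : ∀ j : Fin (k + 1), (Matrix.of fun i j' => contr R C (Fin.tail Xb i) ((Xu ∘ j.succAbove) j')) =
        (Matrix.of fun i j => contr R C (Xb i) (Xu j)).submatrix Fin.succ j.succAbove := fun j => rfl
    rw [genProd_succ, mul_assoc, gaussExpect_gen_mul]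
    simp only [← contr_apply]
    simp only [grassmannDeriv_mul, map_add, mul_add, sum_add_distrib]
    have h1 : ∑ Y, contr R C (Xb 0) Y * gaussExpect R C (grassmannDeriv R Y (genProd R (Fin.tail Xb)) * genProd R Xu) = 0 := by
      have h1' : ∑ Y, contr R C (Xb 0) Y * gaussExpect R C (grassmannDeriv R Y (genProd R (Fin.tail Xb)) * genProd R Xu) =
          gaussExpect R C ((∑ Y, contr R C (Xb 0) Y • grassmannDeriv R Y (genProd R (Fin.tail Xb))) * genProd R Xu) := by
        rw [sum_mul, map_sum]
        exact sum_congr rfl fun Y _ => by rw [smul_mul_assoc, map_smul, smul_eq_mul]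
      rw [h1', hkill, zero_mul, map_zero]
    have h2 : ∑ Y, contr R C (Xb 0) Y *
        gaussExpect R C (CliffordAlgebra.involute (genProd R (Fin.tail Xb)) * grassmannDeriv R Y (genProd R Xu)) =
        (-1 : R) ^ k * ∑ j : Fin (k + 1), contr R C (Xb 0) (Xu j) * (((-1 : R) ^ (j : ℕ)) *
          gaussExpect R C (genProd R (Fin.tail Xb) * genProd R (Xu ∘ j.succAbove))) := by
      simp only [involute_genProd, smul_mul_assoc, map_smul, smul_eq_mul, ← mul_assoc, mul_comm _ ((-1 : R) ^ k)]
      simp only [mul_assoc, ← mul_sum]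
      congr 1
      rw [← gaussExpect_mul_sum_smul, hderu, gaussExpect_mul_sum_smul]
      exact sum_congr rfl fun j _ => by rw [mul_smul_comm, map_smul, smul_eq_mul]
    rw [h1, zero_add, h2, det_succ_row_zero, mul_sum, mul_sum, Nat.choose_succ_succ, Nat.choose_one_right, pow_add]
    refine sum_congr rfl fun j _ => ?_
    rw [gaussExpect_genProd_mul_genProd C (Fin.tail Xb) (Xu ∘ j.succAbove) hb', hminor j, Matrix.of_apply]
    ring

end Charged

/-! ### The Gram–Hadamard bound -/

section Gram

variable {𝕜 : Type*} [RCLike 𝕜] {E : Type*} [NormedAddCommGroup E] [InnerProductSpace 𝕜 E]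
variable {Γ : Type*} [Fintype Γ] [DecidableEq Γ]

/-- A sign does not change the norm of an expectation. [folklore] -/
theorem norm_intCast_units_smul (u : ℤˣ) (x : 𝕜) : ‖((u : ℤ) : 𝕜) * x‖ = ‖x‖ := by
  rcases Int.units_eq_one_or u with rfl | rfl <;> simp

/-- **The Gram–Hadamard bound for the Gaussian expectation of a monomial** (Feldman–Knörrer–Trubowitz 2004,
App. B; Benfatto–Giuliani–Mastropietro 2006, (2.80)): for a charged covariance whose two-point function is in
Gram form on the mixed pairs, `A(X̄, Y) = ⟪f X̄, g Y⟫` with `‖f X̄‖, ‖g Y‖ ≤ κ`, every label string satisfies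
`‖∫ dμ_C ψ(Z₁)⋯ψ(Z_N)‖ ≤ κ^N` — no factorial in `N`. [cite: FeldmanKnorrerTrubowitz2004, App. B] -/
theorem norm_gaussExpect_genProd_le (q : Γ → Bool) (C : Matrix Γ Γ 𝕜) (hC : ∀ X Y, q X = q Y → C X Y = 0)
    (f g : Γ → E) {κ : ℝ} (hκ : 0 ≤ κ) (hf : ∀ X, q X = true → ‖f X‖ ≤ κ) (hg : ∀ Y, q Y = false → ‖g Y‖ ≤ κ)
    (hG : ∀ X Y, q X = true → q Y = false → contr 𝕜 C X Y = ⟪f X, g Y⟫_𝕜)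
    {N : ℕ} (Z : Fin N → Γ) : ‖gaussExpect 𝕜 C (genProd 𝕜 Z)‖ ≤ κ ^ N := by
  set p : Fin N → Prop := fun i => q (Z i) = true with hp
  set a := (univ.filter fun i => p i).card with ha
  set b := (univ.filter fun i => ¬ p i).card with hb
  have hN : a + b = N := by rw [ha, hb, card_filter_add_card_filter_not, card_univ, Fintype.card_fin]
  by_cases hab : b = a
  · -- balanced: sort into block form `ψ̄⋯ψ̄ ψ⋯ψ`
    have hca : Fintype.card {i // p i} = a := by rw [Fintype.card_subtype]
    have hcb : Fintype.card {i // ¬ p i} = a := by rw [Fintype.card_subtype, ← hab]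
    set e₁ : {i // p i} ≃ Fin a := Fintype.equivFinOfCardEq hca with he₁
    set e₂ : {i // ¬ p i} ≃ Fin a := Fintype.equivFinOfCardEq hcb with he₂
    set Xb : Fin a → Γ := fun i => Z (e₁.symm i) with hXb
    set Xu : Fin a → Γ := fun j => Z (e₂.symm j) with hXu
    set σ : Fin N ≃ Fin a ⊕ Fin a := (Equiv.sumCompl p).symm.trans (e₁.sumCongr e₂) with hσ
    have haa : a + a = N := by rw [← hN, hab]
    set ρ : Equiv.Perm (Fin N) := (σ.trans finSumFinEquiv).trans (finCongr haa) with hρ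
    have hZ : Z = (Fin.append Xb Xu ∘ (finCongr haa).symm) ∘ ρ := by
      have hsymm : ∀ x : Fin a ⊕ Fin a, Z (σ.symm x) = Fin.append Xb Xu (finSumFinEquiv x) := by
        rintro (i | j)
        · rw [finSumFinEquiv_apply_left, Fin.append_left, hσ, Equiv.symm_trans_apply, Equiv.symm_symm,
            Equiv.sumCongr_symm, Equiv.sumCongr_apply, Sum.map_inl, Equiv.sumCompl_apply_inl]
        · rw [finSumFinEquiv_apply_right, Fin.append_right, hσ, Equiv.symm_trans_apply, Equiv.symm_symm,
            Equiv.sumCongr_symm, Equiv.sumCongr_apply, Sum.map_inr, Equiv.sumCompl_apply_inr]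
      funext i
      have h := hsymm (σ i)
      rw [Equiv.symm_apply_apply] at h
      rw [h, hρ]
      simp only [Function.comp_apply, Equiv.trans_apply, Equiv.symm_apply_apply]
    have hbb : ∀ i j, contr 𝕜 C (Xb i) (Xb j) = 0 := by
      intro i j
      have hi : q (Xb i) = true := (e₁.symm i).2
      have hj : q (Xb j) = true := (e₁.symm j).2
      rw [contr_apply, hC _ _ (hj.trans hi.symm), hC _ _ (hi.trans hj.symm), sub_self, mul_zero]
    have hdet := gaussExpect_genProd_mul_genProd 𝕜 C Xb Xu hbb
    have hentry : (Matrix.of fun i j => contr 𝕜 C (Xb i) (Xu j)) = Matrix.of fun i j => ⟪f (Xb i), g (Xu j)⟫_𝕜 := by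
      ext i j
      exact hG _ _ (e₁.symm i).2 (Bool.eq_false_iff.2 (e₂.symm j).2)
    rw [hZ, genProd_comp_perm, map_smul, finCongr_symm, genProd_comp_finCongr, genProd_append, hdet, smul_eq_mul, norm_intCast_units_smul,
      norm_mul, norm_pow, norm_neg, norm_one, one_pow, one_mul, hentry]
    refine (Literature.Analysis.InnerProduct.norm_det_inner_le_prod_norm_mul_prod_norm _ _).trans ?_
    calc (∏ i, ‖f (Xb i)‖) * ∏ j, ‖g (Xu j)‖ ≤ (∏ _i : Fin a, κ) * ∏ _j : Fin a, κ :=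
          mul_le_mul (prod_le_prod (fun _ _ => norm_nonneg _) fun i _ => hf _ (e₁.symm i).2)
            (prod_le_prod (fun _ _ => norm_nonneg _) fun j _ => hg _ (Bool.eq_false_iff.2 (e₂.symm j).2))
            (prod_nonneg fun _ _ => norm_nonneg _) (prod_nonneg fun _ _ => hκ)
      _ = κ ^ N := by rw [prod_const, card_univ, Fintype.card_fin, ← pow_add, haa]
  · -- unbalanced: zero
    rw [gaussExpect_genProd_eq_zero_of_charge 𝕜 q C hC Z (Ne.symm hab), norm_zero]
    exact pow_nonneg hκ N

end Gram

end Literature.MathematicalPhysics.QuantumLattice
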